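import Mathlib
import Summits.MatrixMultiplication.MatrixMultiplication.Theorems.LieRankDesigns.Negative.Basics

/-!
# Stub `stub_card_mul_card_frameFibre_le` of the crux `LieRankDesigns` (stmt-MatrixMultiplication-7614)

Crux `LevelGradedCohnUmans.LieRankDesigns` (stmt-MatrixMultiplication-7614), line `Sketch`, lead seat
prover-line-stmt-MatrixMultiplication-7614-c4-0; registered stub `stub_card_mul_card_frameFibre_le` =
level-`k` frame-token count no. 2, generalising `card_mul_card_fibre_le` of
`Theorems/LieRankDesigns/Negative/PrivateTokenCounts.lean` from vectors (`k = 1`) to `m × k` frames.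

For a triple `X, Y, Z ⊆ GL_m(𝔽_p)` with a FREE-FRAME witness `v : X × Z → M_{m×k}(𝔽_p)` —
`x⁻¹ y y'⁻¹ z · v(x₀,z₀) = x₀⁻¹ z₀ · v(x₀,z₀) ⟹ (x, y, y', z)` trivial — and any frame `U`, put
`Z_U = {z₀ ∈ Z : ∃ x₀ ∈ X, v(x₀,z₀) = U}`.  The map `(y, z₀) ↦ y⁻¹ z₀ U` is injective on `Y × Z_U`
(a coincidence `y⁻¹ z₀ U = y₁⁻¹ z₁ U`, with `v(x₀,z₀) = U`, is the violating quadruple `(x₀, y, y₁, z₁)`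
of the target `(x₀, z₀)`), so `|Y| · |Z_U| ≤ |M_{m×k}(𝔽_p)| = p^{mk}`: a frame serves at most
`p^{mk} / |Y|` third elements.
-/

set_option linter.dupNamespace false

noncomputable section

open scoped BigOperators

namespace Summit.MatrixMultiplication.MatrixMultiplication.Theorems.LieRankDesigns

open Summit.MatrixMultiplication.MatrixMultiplication.Theorems.LieRankDesigns.Negative
  (GLm Mat fourierFn RankSupp RankSep levelSet budget volume)

/-- `(g h) · U = g · (h · U)` for `g, h ∈ GL_m(𝔽_p)` acting on `m × k` frames `U`. -/
theorem coe_mul_mul_frame {p m k : ℕ} (g h : GLm p m) (U : Matrix (Fin m) (Fin k) (ZMod p)) :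
    ((g * h : GLm p m) : Mat p m) * U = (g : Mat p m) * ((h : Mat p m) * U) := by
  rw [Units.val_mul, Matrix.mul_assoc]

/-- There are `p^{mk}` frames: `|M_{m×k}(𝔽_p)| = p^{mk}`. -/
theorem card_univ_frame (p m k : ℕ) [Fact p.Prime] :
    (Finset.univ : Finset (Matrix (Fin m) (Fin k) (ZMod p))).card = p ^ (m * k) := by
  rw [Finset.card_univ]
  change Fintype.card (Fin m → Fin k → ZMod p) = _
  rw [Fintype.card_fun, Fintype.card_fun, ZMod.card, Fintype.card_fin, Fintype.card_fin, ← pow_mul,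
    mul_comm]

/-- **Z-singletons at level `k`** (registered stub `stub_card_mul_card_frameFibre_le`).  For a free-frame
witness `v` of `X, Y, Z ⊆ GL_m(𝔽_p)` and any frame `U ∈ M_{m×k}(𝔽_p)`, with
`Z_U = {z₀ ∈ Z : ∃ x₀ ∈ X, v x₀ z₀ = U}`: `|Y| · |Z_U| ≤ p^{mk}` — the map `(y, z₀) ↦ y⁻¹ z₀ U` is
injective on `Y × Z_U`, a coincidence being a violating quadruple `(x₀, y, y₁, z₁)` of the target
`(x₀, z₀)` that carries the frame `U`. -/
theorem stub_card_mul_card_frameFibre_le :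
    ∀ (p m k : ℕ) [Fact p.Prime] (X Y Z : Finset (GLm p m))
      (v : GLm p m → GLm p m → Matrix (Fin m) (Fin k) (ZMod p)),
      (∀ x₀ ∈ X, ∀ z₀ ∈ Z, ∀ x ∈ X, ∀ y ∈ Y, ∀ y' ∈ Y, ∀ z ∈ Z,
        ((x⁻¹ * y * y'⁻¹ * z : GLm p m) : Mat p m) * v x₀ z₀ =
          ((x₀⁻¹ * z₀ : GLm p m) : Mat p m) * v x₀ z₀ → x = x₀ ∧ y = y' ∧ z = z₀) →
      ∀ U : Matrix (Fin m) (Fin k) (ZMod p),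
        Y.card * (Z.filter fun z₀ => ∃ x₀ ∈ X, v x₀ z₀ = U).card ≤ p ^ (m * k) := by
  intro p m k _ X Y Z v hPT U
  rw [← card_univ_frame p m k, ← Finset.card_product]
  refine Finset.card_le_card_of_injOn (fun q => ((q.1⁻¹ * q.2 : GLm p m) : Mat p m) * U)
    (fun q _ => Finset.mem_univ _) ?_
  rintro ⟨y, z₀⟩ h₀ ⟨y₁, z₁⟩ h₁ heq
  simp only [Finset.coe_product, Finset.coe_filter, Set.mem_prod, Finset.mem_coe,
    Set.mem_setOf_eq] at h₀ h₁
  obtain ⟨hy, hz₀, x₀, hx₀, hv₀⟩ := h₀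
  obtain ⟨hy₁, hz₁, -⟩ := h₁
  -- the quadruple (x₀, y, y₁, z₁) of the target (x₀, z₀)
  have heq' : ((y₁⁻¹ * z₁ : GLm p m) : Mat p m) * U = ((y⁻¹ * z₀ : GLm p m) : Mat p m) * U :=
    heq.symm
  have key : ((x₀⁻¹ * y * y₁⁻¹ * z₁ : GLm p m) : Mat p m) * v x₀ z₀ =
      ((x₀⁻¹ * z₀ : GLm p m) : Mat p m) * v x₀ z₀ := by
    rw [hv₀]
    have e1 : (x₀⁻¹ * y * y₁⁻¹ * z₁ : GLm p m) = x₀⁻¹ * y * (y₁⁻¹ * z₁) := by group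
    have e2 : (x₀⁻¹ * z₀ : GLm p m) = x₀⁻¹ * y * (y⁻¹ * z₀) := by group
    rw [e1, e2, coe_mul_mul_frame (x₀⁻¹ * y), coe_mul_mul_frame (x₀⁻¹ * y), heq']
  obtain ⟨-, hyy, hzz⟩ := hPT x₀ hx₀ z₀ hz₀ x₀ hx₀ y hy y₁ hy₁ z₁ hz₁ key
  rw [hyy, hzz]

end Summit.MatrixMultiplication.MatrixMultiplication.Theorems.LieRankDesigns

end
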